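import Summits.CriticalPhenomena.PercolationContinuityZ3.Theorems.PercNearOneGluingNoHeavyLowerTailSunflowerTBernTwo
import HarnessLib

/-!
# `NoHeavyLowerTail` (crux stmt-CriticalPhenomena-4575), abstract sunflower cubic: T-BERN — FLOOR INDUCTION
# (the reduction of `TBern` to floor-free families)

Support file (seat `prim-ineq-prove-1` gen 63; `--supports stmt-CriticalPhenomena-4575`).  No `sorry`, no named facts.
Memo: run/shared/lean/prim/prim-ineq-prove-1/FINDING-CONVEX-prove1-g63.md §2 (step (a)).

The hypotheses of `TBern s b β V` for a family on `n` petals, restated for a family indexed by a FINSET `t`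
(`AdmissibleOn`, budgets with exponent `|t| − 1`), and the `CoefDom` certificate it should satisfy (`DomOn`: the family
polynomial is dominated by `(A₀X + a₀)^(|t|−1)(X + V)`).  A FLOOR petal (`u_j = b`, `vv_j = β`, `m_j = b`) contributes the factor
`A₀X + a₀` to the family polynomial and exactly `b`, `β`, `a₀` to the three budgets, so it can be erased:
`admissibleOn_erase_floor`, `domOn_of_erase_floor`.  Hence (**`domOn_of_floorFree`**, strong induction on `|t|`): if every
NONEMPTY FLOOR-FREE admissible family admits the certificate, every nonempty admissible family does; and (**`tbern_of_floorFree`**)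
`TBern s b β V` follows.  Singletons are certified directly (`domOn_singleton`), pairs by `…SunflowerTBernTwo`
(`domOn_pair`); so the first open case is a floor-free admissible family of three petals.
-/

noncomputable section

namespace Summit.CriticalPhenomena.PercolationContinuityZ3.Theorems.SunflowerPartition

namespace SafeCalc

namespace LinkedCurrency

open Finset Polynomial

variable {ι : Type*} [DecidableEq ι]

/-- The hypotheses of `TBern s b β V` for a family `(u, vv, m)` on the finset `t` (budgets with exponent `|t| − 1`).
[definition, this work] -/
def AdmissibleOn (s b β V : ℝ) (t : Finset ι) (u vv m : ι → ℝ) : Prop :=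
  (∀ j ∈ t, b ≤ u j) ∧ (∀ j ∈ t, u j ≤ 1) ∧ (∀ j ∈ t, β ≤ vv j) ∧ (∀ j ∈ t, vv j ≤ V) ∧ (∀ j ∈ t, b ≤ m j) ∧
    (∀ j ∈ t, m j ≤ u j) ∧ (∀ j ∈ t, m j ≤ vv j) ∧ ∏ j ∈ t, u j ≤ b ^ (t.card - 1) ∧
    ∏ j ∈ t, vv j ≤ β ^ (t.card - 1) * V ∧
    ∏ j ∈ t, ((1 - s) * m j + s * vv j) ≤ ((1 - s) * b + s * β) ^ (t.card - 1) * V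

/-- The `CoefDom` certificate of a family on `t`: `∏_{j∈t}(A_jX + g_j) ≤_coef (A₀X + a₀)^(|t|−1)(X + V)`.
[definition, this work] -/
def DomOn (s b β V : ℝ) (t : Finset ι) (u vv m : ι → ℝ) : Prop :=
  CoefDom (prodPoly t (fun j => s + (1 - s) * u j) (fun j => (1 - s) * m j + s * vv j))
    ((C (s + (1 - s) * b) * X + C ((1 - s) * b + s * β)) ^ (t.card - 1) * (C 1 * X + C V))

/-- Petal `j` is a FLOOR: `(u_j, vv_j, m_j) = (b, β, b)`. [definition, this work] -/
def IsFloor (b β : ℝ) (u vv m : ι → ℝ) (j : ι) : Prop := u j = b ∧ vv j = β ∧ m j = b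

omit [DecidableEq ι] in
/-- Admissibility restricts to sub-hypotheses pointwise (helper). [this work] -/
theorem AdmissibleOn.bounds {s b β V : ℝ} {t : Finset ι} {u vv m : ι → ℝ} (h : AdmissibleOn s b β V t u vv m) :
    (∀ j ∈ t, b ≤ u j) ∧ (∀ j ∈ t, u j ≤ 1) ∧ (∀ j ∈ t, β ≤ vv j) ∧ (∀ j ∈ t, vv j ≤ V) ∧ (∀ j ∈ t, b ≤ m j) ∧
      (∀ j ∈ t, m j ≤ u j) ∧ (∀ j ∈ t, m j ≤ vv j) :=
  ⟨h.1, h.2.1, h.2.2.1, h.2.2.2.1, h.2.2.2.2.1, h.2.2.2.2.2.1, h.2.2.2.2.2.2.1⟩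

/-- **Erasing a floor keeps admissibility** (the floor contributes exactly `b`, `β`, `a₀` to the budgets). [this work] -/
theorem admissibleOn_erase_floor {s b β V : ℝ} (hb : 0 < b) (hbβ : b ≤ β) (hs0 : 0 ≤ s) (hs1 : s ≤ 1)
    {t : Finset ι} {u vv m : ι → ℝ} (h : AdmissibleOn s b β V t u vv m) {j : ι} (hj : j ∈ t)
    (hfl : IsFloor b β u vv m j) (hcard : 2 ≤ t.card) : AdmissibleOn s b β V (t.erase j) u vv m := by
  obtain ⟨hub, hu1, hvβ, hv1, hmb, hmu, hmv, hpu, hpv, hpg⟩ := h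
  obtain ⟨huj, hvj, hmj⟩ := hfl
  have hβ : 0 < β := hb.trans_le hbβ
  have hs' : 0 ≤ 1 - s := sub_nonneg.2 hs1
  have ha₀ : 0 < (1 - s) * b + s * β := by
    have : 0 ≤ s * (β - b) := mul_nonneg hs0 (sub_nonneg.2 hbβ)
    nlinarith
  have hce : (t.erase j).card = t.card - 1 := card_erase_of_mem hj
  have hexp : t.card - 1 = ((t.erase j).card - 1) + 1 := by rw [hce]; omega
  have sub : ∀ {p : ι → Prop}, (∀ i ∈ t, p i) → ∀ i ∈ t.erase j, p i := fun hp i hi => hp i (mem_of_mem_erase hi)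
  refine ⟨sub hub, sub hu1, sub hvβ, sub hv1, sub hmb, sub hmu, sub hmv, ?_, ?_, ?_⟩
  · rw [← mul_prod_erase t u hj, huj, hexp, pow_succ, mul_comm (b ^ _) b] at hpu
    exact le_of_mul_le_mul_left hpu hb
  · rw [← mul_prod_erase t vv hj, hvj, hexp, pow_succ, mul_comm (β ^ _) β, mul_assoc] at hpv
    exact le_of_mul_le_mul_left hpv hβ
  · rw [← mul_prod_erase t (fun j => (1 - s) * m j + s * vv j) hj, hmj, hvj, hexp, pow_succ,
      mul_comm (((1 - s) * b + s * β) ^ _) ((1 - s) * b + s * β), mul_assoc] at hpg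
    exact le_of_mul_le_mul_left hpg ha₀

/-- **Re-inserting a floor keeps the certificate.** [this work] -/
theorem domOn_of_erase_floor {s b β V : ℝ} (hb : 0 < b) (hbβ : b ≤ β) (hs0 : 0 ≤ s) (hs1 : s ≤ 1)
    {t : Finset ι} {u vv m : ι → ℝ} {j : ι} (hj : j ∈ t) (hfl : IsFloor b β u vv m j) (hne : (t.erase j).Nonempty)
    (h : DomOn s b β V (t.erase j) u vv m) : DomOn s b β V t u vv m := by
  obtain ⟨huj, hvj, hmj⟩ := hfl
  have hs' : 0 ≤ 1 - s := sub_nonneg.2 hs1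
  have hF₁ : 0 ≤ s + (1 - s) * b := by nlinarith
  have hF₀ : 0 ≤ (1 - s) * b + s * β := by nlinarith [hb.trans_le hbβ]
  unfold DomOn at h ⊢
  rw [← insert_erase hj]
  exact coefDom_prodPoly_insert_floor (notMem_erase j t) hne hF₁ hF₀ (by simp only [huj]) (by simp only [hmj, hvj]) h

omit [DecidableEq ι] in
/-- **A single admissible petal is certified**: `A_j X + g_j ≤_coef X + V`. [this work] -/
theorem domOn_singleton {s b β V : ℝ} (hs0 : 0 ≤ s) (hs1 : s ≤ 1) {u vv m : ι → ℝ} {j : ι}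
    (hu1 : u j ≤ 1) (hmv : m j ≤ vv j) (hv1 : vv j ≤ V) : DomOn s b β V {j} u vv m := by
  have hs' : 0 ≤ 1 - s := sub_nonneg.2 hs1
  unfold DomOn
  refine coefDom_prodPoly_singleton ?_ ?_
  · nlinarith [mul_le_mul_of_nonneg_left hu1 hs']
  · nlinarith [mul_le_mul_of_nonneg_left (hmv.trans hv1) hs', mul_le_mul_of_nonneg_left hv1 hs0]

/-- **An admissible pair is certified** (`…SunflowerTBernTwo`). [this work] -/
theorem domOn_pair {s b β V : ℝ} (hb : 0 < b) (hbβ : b ≤ β) (hs0 : 0 ≤ s) (hs1 : s ≤ 1)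
    {u vv m : ι → ℝ} {i j : ι} (hij : i ≠ j) (h : AdmissibleOn s b β V {i, j} u vv m) :
    DomOn s b β V {i, j} u vv m := by
  obtain ⟨hub, hu1, hvβ, hv1, hmb, hmu, hmv, hpu, hpv, hpg⟩ := h
  have hi : i ∈ ({i, j} : Finset ι) := mem_insert_self i {j}
  have hj : j ∈ ({i, j} : Finset ι) := mem_insert_of_mem (mem_singleton_self j)
  have hcard : ({i, j} : Finset ι).card - 1 = 1 := by rw [card_pair hij]
  unfold DomOn
  rw [hcard, pow_one] at hpu hpv hpg ⊢
  rw [prod_pair hij] at hpu hpv hpg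
  have hnot : i ∉ ({j} : Finset ι) := by rwa [mem_singleton]
  rw [prodPoly_insert hnot, prodPoly_singleton]
  exact coefDom_pair hb hbβ hs0 hs1 (hub i hi) (hu1 i hi) (hub j hj) (hu1 j hj) (hvβ i hi) (hvβ j hj) (hmb i hi)
    (hmu i hi) (hmv i hi) (hmb j hj) (hmu j hj) (hmv j hj) hpu hpv hpg

/-- **FLOOR INDUCTION.**  If every nonempty floor-free admissible family on a finset of `ι` admits the certificate, then every
nonempty admissible family does. [this work] -/
theorem domOn_of_floorFree {s b β V : ℝ} (hb : 0 < b) (hbβ : b ≤ β) (hs0 : 0 ≤ s) (hs1 : s ≤ 1)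
    (H : ∀ (t : Finset ι) (u vv m : ι → ℝ), t.Nonempty → AdmissibleOn s b β V t u vv m →
      (∀ j ∈ t, ¬ IsFloor b β u vv m j) → DomOn s b β V t u vv m)
    (t : Finset ι) (u vv m : ι → ℝ) (hne : t.Nonempty) (hadm : AdmissibleOn s b β V t u vv m) :
    DomOn s b β V t u vv m := by
  induction' hn : t.card using Nat.strong_induction_on with n ih generalizing t
  by_cases hfloor : ∃ j ∈ t, IsFloor b β u vv m j
  · obtain ⟨j, hj, hfl⟩ := hfloor
    rcases Nat.lt_or_ge t.card 2 with hlt | hge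
    · -- `t = {j}`
      have hc1 : t.card = 1 := by have := hne.card_pos; omega
      obtain ⟨i, hi⟩ := card_eq_one.1 hc1
      have hij : j = i := by rw [hi] at hj; exact mem_singleton.1 hj
      subst hij
      rw [hi]
      obtain ⟨_, hu1, _, hv1, _, _, hmv, _⟩ := hadm
      exact domOn_singleton hs0 hs1 (hu1 j hj) (hmv j hj) (hv1 j hj)
    · have hne' : (t.erase j).Nonempty := by
        rw [← card_pos, card_erase_of_mem hj]; omega
      have hadm' := admissibleOn_erase_floor hb hbβ hs0 hs1 hadm hj hfl hge
      have hlt : (t.erase j).card < n := by rw [card_erase_of_mem hj]; omega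
      exact domOn_of_erase_floor hb hbβ hs0 hs1 hj hfl hne' (ih _ hlt (t.erase j) hne' hadm' rfl)
  · push Not at hfloor
    exact H t u vv m hne hadm hfloor

/-- **`TBern` from the floor-free families.**  If, for every `n`, every nonempty floor-free admissible family on a finset of
`Fin n` admits the `CoefDom` certificate, then `TBern s b β V`. [this work] -/
theorem tbern_of_floorFree {s b β V : ℝ} (hb : 0 < b) (hbβ : b ≤ β) (hs0 : 0 ≤ s) (hs1 : s ≤ 1)
    (H : ∀ (n : ℕ) (t : Finset (Fin n)) (u vv m : Fin n → ℝ), t.Nonempty → AdmissibleOn s b β V t u vv m →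
      (∀ j ∈ t, ¬ IsFloor b β u vv m j) → DomOn s b β V t u vv m) :
    TBern s b β V := by
  refine tbern_of_coefDom fun n u vv m hn hub hu1 hvβ hv1 hmb hmu hmv hpu hpv hpg => ?_
  have hadm : AdmissibleOn s b β V (univ : Finset (Fin n)) u vv m := by
    refine ⟨fun j _ => hub j, fun j _ => hu1 j, fun j _ => hvβ j, fun j _ => hv1 j, fun j _ => hmb j,
      fun j _ => hmu j, fun j _ => hmv j, ?_, ?_, ?_⟩ <;> rw [card_univ, Fintype.card_fin] <;> assumption
  have hne : (univ : Finset (Fin n)).Nonempty := univ_nonempty_iff.2 ⟨⟨0, hn⟩⟩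
  have key := domOn_of_floorFree hb hbβ hs0 hs1 (H n) univ u vv m hne hadm
  unfold DomOn at key
  rw [card_univ, Fintype.card_fin] at key
  exact key

end LinkedCurrency

end SafeCalc

end Summit.CriticalPhenomena.PercolationContinuityZ3.Theorems.SunflowerPartition
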